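import Summits.BirchSwinnertonDyer.BirchSwinnertonDyer.Theorems.TwoAdicConverseOrdLambdaHalfAtTwoThetaSupplyOfPrint
import Summits.BirchSwinnertonDyer.Rank1Residual.AdditivePotMult.TwistPointsOver
import Literature.NumberTheory.EllipticCurves.FineSelmerBaseChangeModelProofs
import Literature.NumberTheory.EllipticCurves.IwasawaDualComparisonLambdaProofs
import Literature.NumberTheory.EllipticCurves.KatoFineSelmerFiniteProofs
import Literature.NumberTheory.EllipticCurves.Kato2004.TateModuleFilAtInertiaProofs
import Literature.NumberTheory.EllipticCurves.ZpExtensionRestrictTwoSqrtTwo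
import Literature.NumberTheory.GaloisRepresentations.LocalKroneckerWeberInertiaProofs
import Literature.NumberTheory.QuadraticFields.SquareRootGenerator
import HarnessLib

/-!
# Route `TwoAdicConverse`, crux `OrdLambdaHalfAtTwo` (stmt-BirchSwinnertonDyer-19556), line `kato_determinant_greenberg_two` —
# the memo binder (S) `LambdaShapiroFineAtTwo` IS A THEOREM: `λ(X₀(E/K_∞)) = λ(X₀(E/ℚ_∞)) + λ(X₀(E^{(d_K)}/ℚ_∞))`,
# and stub 4‴ `ThetaShapiroKatoGreenbergSupplyAtTwo` follows from PRINTED named facts alone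

Seat `bsd-2adic-conv-1` GEN 32 (cell `pub/bsd-2adic`; `--supports stmt-BirchSwinnertonDyer-19556`).  HONEST FRAMING: BSD is not proved
by any of this; the crux is NOT proved here (stub 6‴ is research).  What this file does: the λ-SHAPIRO identity for the fine Selmer
duals along an imaginary quadratic `K/ℚ` — displayed by the line as the OPEN memo-tier binder `TwoAdicShapiroPT.LambdaShapiroFineAtTwo`
(GEN 28, pen RC-362 (B) tier t3: «EITHER proved in the kernel as module algebra … OR a Theorems-side memo-tier def») — is
PROVED IN THE KERNEL, from tree tools only (no named fact is introduced or consumed):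

* the fine `±`-decomposition over `ℚ_∞` INSIDE `Γ_ℚ` (`Literature/…/FineSelmerQuadraticLayerProofs`, this seat: Dokchitser–Dokchitser's
  index-`2` mechanism `IndexTwoDecompositionData` run on `Sel₀`, with target the classes on `Gal(ℚ̄/K_∞)` locally trivial at EVERY
  prime of `\bar ℤ`; kernel killed by `4`, `4 ·` target in the image);
* the identification of that target with the GENUINE `Sel₀(K_∞, E_K[2^∞])` (`Literature/…/FineSelmerBaseChangeModelProofs`, this seat, on
  t42's `subgroupModelIso`; `K` totally complex);
* the comparison theorem for Pontryagin duals (`Literature/…/IwasawaDualComparisonLambdaProofs`, this seat: a two-map comparison with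
  `p^j`-bounded kernel/cokernel is a `ℚ_p ⊗ ·`-isomorphism on ANY bijective dual data, so `λ = dim_{ℚ_p}(ℚ_p ⊗ ·)` adds and torsion
  transfers) and `FineSelmerDualData.module_finite` (Coates–Sujatha §3 / Greenberg p. 60, tree) for the finite generation of `X₀(E/K_∞)`;
* §1–§2 here: the quadratic field bookkeeping (`√d_K ∈ K`, `Gal(ℚ̄/K) = Stab(√d_K)`, `ker κ_K = res⁻¹ ker κ` for the two CYCLOTOMIC
  `ℤ₂`-extensions — directly from `IsCyclotomic` and `χ_{2,K} = χ_{2,ℚ} ∘ res`, no surjectivity of `κ ∘ res` needed — and a `c ∈ ker κ`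
  with `c √d_K = −√d_K`).

§3 **`lambdaShapiroFineAtTwo_holds : LambdaShapiroFineAtTwo`**.  §4 **`thetaShapiroKatoGreenbergSupplyAtTwo_of_print'`**: stub 4‴ from the
SIX printed named facts {PUB, F3-K, (12.2.3), X₀-torsion, Kato 12.4, PT-K} (ORD is the tree theorem `tateModuleFilAt_inertia_ordinary_holds`,
audit-2 p701851; (S) is §3).  So the line reads «19556|(β) ⟸ 6‴ + PRINT».

References: [DokchitserDokchitserAnnals2010] Lemma 4.14; [CoatesSujatha2005] §3; [GreenbergLNM1716] §1 p. 60, §2, §4 p. 107; [Washington1997] §13.1–13.2;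
[NeukirchSchmidtWingberg2008] (1.6.4); [Imai1975] (not needed: the `λ`-currency absorbs the finite/exponent-`2` defects without Imai).
-/

set_option autoImplicit false
set_option linter.dupNamespace false

noncomputable section

open scoped Classical NumberField Pointwise

open Field IsDedekindDomain WeierstrassCurve
open Literature.NumberTheory.GaloisRepresentations
open Literature.NumberTheory.EllipticCurves Literature.NumberTheory.EllipticCurves.Kato2004
open Literature.NumberTheory.EllipticCurves.QuadraticLayer Literature.NumberTheory.EllipticCurves.FineQuadraticLayer
  Literature.NumberTheory.EllipticCurves.FineBaseChangeModel Literature.NumberTheory.EllipticCurves.BaseChangeModel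
  Literature.NumberTheory.EllipticCurves.IwasawaDual Literature.NumberTheory.EllipticCurves.QuadraticTwistSelmer
open Literature.NumberTheory.QuadraticFields.Quadratic
open Summit.BirchSwinnertonDyer.Rank1Residual.AdditivePotMult

namespace Summit.BirchSwinnertonDyer.BirchSwinnertonDyer.Theorems.TwoAdicShapiroPT

/-! ## §1 The imaginary quadratic field: `√d_K ∈ K`, `Gal(ℚ̄/K) = Stab(√d_K)`, a `c ∈ ker κ` negating `√d_K` -/

section Field

variable (K : Type) [Field K] [NumberField K]

/-- **`√d_K ∈ K ∖ ℚ`** for a quadratic field: with `K = ℚ(θ₀)`, `θ₀² = c`, `d_K = c q²` (tree `NumberField.exists_discr_eq_mul_sq`),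
`δ = q θ₀`. [cite: Marcus1977, Ch. 2 Thm. 1] -/
theorem exists_sq_eq_discr (h2 : Module.finrank ℚ K = 2) :
    ∃ δ : K, δ ∉ Set.range (algebraMap ℚ K) ∧ δ ^ 2 = algebraMap ℚ K (NumberField.discr K : ℚ) := by
  obtain ⟨θ₀, c, hθ₀, hc⟩ := exists_sq_eq_algebraMap (F := ℚ) (K := K) h2
  obtain ⟨q, hq0, hq⟩ := NumberField.exists_discr_eq_mul_sq h2 hθ₀ hc
  refine ⟨algebraMap ℚ K q * θ₀, ?_, ?_⟩
  · rintro ⟨r, hr⟩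
    apply hθ₀
    refine ⟨r / q, ?_⟩
    rw [map_div₀, hr, mul_div_cancel_left₀ _ ((map_ne_zero _).mpr hq0)]
  · rw [mul_pow, hc, ← map_pow, ← map_mul, hq, mul_comm]

variable {K} (h2 : Module.finrank ℚ K = 2) {δ : K} {d : ℚ} (hδ : δ ∉ Set.range (algebraMap ℚ K))
  (hd : δ ^ 2 = algebraMap ℚ K d)

include h2 hδ hd in
/-- **`Gal(ℚ̄/K) = Stab(θ)` for every `θ ∈ ℚ̄` with `θ² = d`** (`θ = ±t`, `t = rootInClosure K δ`; sign rules
`apply_rootInClosure_of_(not_)mem`). [cite: Marcus1977, Ch. 2 Thm. 1] [cite: SerreGaloisCohomology1997, II.§1.1] -/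
theorem mem_galRange_iff_smul_eq {θ : AlgebraicClosure ℚ} (hθ : θ ^ 2 = algebraMap ℚ (AlgebraicClosure ℚ) d)
    (σ : absoluteGaloisGroup ℚ) : σ ∈ galRange (K := ℚ) K ↔ σ • θ = θ := by
  have hd0 : d ≠ 0 := sq_ne_zero_of_not_mem_range hδ hd
  have ht0 : rootInClosure K δ ≠ 0 := fun h0 ↦ by
    have hsq := rootInClosure_sq K hd
    rw [h0, zero_pow two_ne_zero, eq_comm, map_eq_zero] at hsq
    exact hd0 hsq
  have key : σ ∈ galRange (K := ℚ) K ↔ σ • rootInClosure K δ = rootInClosure K δ := by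
    constructor
    · exact fun h ↦ apply_rootInClosure_of_mem K h
    · intro h
      by_contra hσ
      have hneg : σ • rootInClosure K δ = -rootInClosure K δ := apply_rootInClosure_of_not_mem K h2 hδ hd hσ
      rw [h] at hneg
      have h2' : (2 : AlgebraicClosure ℚ) * rootInClosure K δ = 0 := by
        rw [two_mul]; nth_rw 2 [hneg]; rw [add_neg_cancel]
      rcases mul_eq_zero.mp h2' with h0 | h0
      · exact two_ne_zero h0
      · exact ht0 h0
  have hsq : θ ^ 2 = rootInClosure K δ ^ 2 := by rw [hθ, rootInClosure_sq K hd]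
  rw [key]
  rcases sq_eq_sq_iff_eq_or_eq_neg.mp hsq with h | h
  · rw [h]
  · rw [h, smul_neg, neg_inj]

include h2 hδ hd in
/-- **A lift `c₀ ∈ Γ_ℚ` of the non-trivial automorphism of `K` negates `θ`** (`θ² = d`). [cite: Marcus1977, Ch. 2 Thm. 1] -/
theorem exists_smul_eq_neg {θ : AlgebraicClosure ℚ} (hθ : θ ^ 2 = algebraMap ℚ (AlgebraicClosure ℚ) d) :
    ∃ c₀ : absoluteGaloisGroup ℚ, c₀ • θ = -θ := by
  set c₀ := liftToAbsGal (K := ℚ) K (sigmaQ K h2 hδ hd) with hc₀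
  have hc₀t : c₀ • rootInClosure K δ = -rootInClosure K δ := by
    have h := liftToAbsGal_embIntoClosure (K := ℚ) K (sigmaQ K h2 hδ hd) δ
    rw [sigmaQ_gen, map_neg] at h
    exact h
  have hsq : θ ^ 2 = rootInClosure K δ ^ 2 := by rw [hθ, rootInClosure_sq K hd]
  refine ⟨c₀, ?_⟩
  rcases sq_eq_sq_iff_eq_or_eq_neg.mp hsq with h | h
  · rw [h, hc₀t]
  · rw [h, smul_neg, hc₀t, neg_neg]

end Field

/-! ## §2 The cyclotomic `ℤ₂`-extensions of `ℚ` and `K`: `ker κ_K = res⁻¹ ker κ`, `galImage(ker κ_K) = kerStab κ θ` -/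

section Cyclotomic

variable {K : Type} [Field K] [NumberField K] {p : ℕ} [Fact p.Prime]
  {κ : ZpExtension ℚ p} {κK : ZpExtension K p} (hκ : κ.IsCyclotomic) (hκK : κK.IsCyclotomic)

include hκ hκK in
/-- **`ker κ_K = res⁻¹(ker κ)` for the cyclotomic `ℤ_p`-extensions of `K` and of `ℚ`**: both kernels are `χ_p⁻¹(μ(ℤ_p))`
(`IsCyclotomic`) and `χ_{p,K} = χ_{p,ℚ} ∘ res` (`cyclotomicCharacter_absGaloisRestrict`) — whatever the normalisations of `κ`, `κ_K`.
[cite: Washington1997, §13.1] -/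
theorem mem_kerSubgroup_iff_resGal_mem (τ : absoluteGaloisGroup K) :
    τ ∈ κK.kerSubgroup ↔ resGal (K := ℚ) K τ ∈ κ.kerSubgroup := by
  have hK : κK.kerSubgroup = _ := hκK
  have hQ : κ.kerSubgroup = _ := hκ
  rw [hK, hQ, Subgroup.mem_comap, Subgroup.mem_comap, resGal_eq_absGaloisRestrict]
  change GaloisRep.cyclotomicCharacter K p τ ∈ CommGroup.torsion ℤ_[p]ˣ ↔
    GaloisRep.cyclotomicCharacter ℚ p (absGaloisRestrict ℚ K τ) ∈ CommGroup.torsion ℤ_[p]ˣ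
  rw [cyclotomicCharacter_absGaloisRestrict]

include hκ hκK in
/-- **`galImage(ker κ_K) = kerStab κ θ = Gal(ℚ̄/K·ℚ_∞)`** when `Gal(ℚ̄/K) = Stab(θ)`. [cite: Washington1997, §13.1] [cite: GreenbergLNM1716, §4 p. 107] -/
theorem galImage_kerSubgroup_eq_kerStab {θ : AlgebraicClosure ℚ}
    (hgal : ∀ σ : absoluteGaloisGroup ℚ, σ ∈ galRange (K := ℚ) K ↔ σ • θ = θ) :
    galImage ℚ K κK.kerSubgroup = kerStab κ θ := by
  ext g
  rw [mem_galImage_iff, mem_kerStab_iff]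
  constructor
  · rintro ⟨σ, hσ, rfl⟩
    exact ⟨(mem_kerSubgroup_iff_resGal_mem hκ hκK σ).1 hσ, (hgal _).1 ⟨σ, rfl⟩⟩
  · rintro ⟨hker, hfix⟩
    obtain ⟨σ, rfl⟩ := (hgal g).2 hfix
    exact ⟨σ, (mem_kerSubgroup_iff_resGal_mem hκ hκK σ).2 hker, rfl⟩

end Cyclotomic

/-! ## §3 (S) IS A THEOREM -/

section Main

-- adapted from `Theorems/TwoAdicConverseOrdLambdaHalfAtTwoShapiroLatticeSupply.lean` (`sq_ne_two`, conv-1 GEN 30)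
/-- **`√2 ∉ K`** for `K` imaginary quadratic (`x² = 2`, `x ∉ ℚ` would force `d_K = 2q² > 0`). [cite: Marcus1977, Ch. 2 Thm. 1] -/
theorem sq_ne_two_of_isImaginaryQuadratic {K : Type} [Field K] [NumberField K] (hK : IsImaginaryQuadratic K) (x : K) :
    x ^ 2 ≠ 2 := by
  intro hx
  have hx' : x ^ 2 = algebraMap ℚ K 2 := by rw [hx, map_ofNat]
  have hxK : x ∉ Set.range (algebraMap ℚ K) := by
    rintro ⟨q, rfl⟩
    have hq : (q : ℝ) ^ 2 = 2 := by
      rw [← map_pow] at hx'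
      have := (algebraMap ℚ K).injective hx'
      exact_mod_cast congrArg (fun r : ℚ ↦ (r : ℝ)) this
    refine irrational_sqrt_two ⟨|q|, ?_⟩
    rw [Rat.cast_abs, ← Real.sqrt_sq_eq_abs, hq]
  obtain ⟨q, hq0, hq⟩ := NumberField.exists_discr_eq_mul_sq hK.1 hxK hx'
  have hneg : (NumberField.discr K : ℚ) < 0 := by exact_mod_cast hK.discr_neg
  have hpos : (0 : ℚ) < 2 * q ^ 2 := by positivity
  linarith

/-- **(S) `LambdaShapiroFineAtTwo` IS A THEOREM: `X₀(E/K_∞)` is finitely generated `Λ`-torsion and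
`λ(X₀(E/K_∞)) = λ(X₀(E/ℚ_∞)) + λ(X₀(E^{(d_K)}/ℚ_∞))`** for `E/ℚ` elliptic, `K` imaginary quadratic, `A` a `ℚ`-model of
`E^{(d_K)}`, the cyclotomic `ℤ₂`-extensions of `ℚ` and `K` with ANY topological generators, and ANY Pontryagin dual data
`Y_W`, `Y_A` (f.g. torsion) and `Dfi`.  Assembly: `√d_K ∈ K`, `θ = √d_K ∈ ℚ̄`, `Gal(ℚ̄/K) = Stab θ`, `galImage(ker κ_K) = kerStab κ θ`
(§1–§2), `c ∈ ker κ` with `cθ = −θ` (§1 + `κ ∘ res` onto, `√2 ∉ K`); the comparison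
`Φ(s, s′) = Θ⁻¹(res s + Ψ res s′) : Sel₀(ℚ_∞, E) × Sel₀(ℚ_∞, A) → Sel₀(K_∞, E_K)` (Θ = `subgroupModelIso`, fine membership by
`FineBaseChangeModel`) has kernel killed by `4` and `4 · Sel₀(K_∞, E_K)` in its image (`FineQuadraticLayer`); the dual comparison theorem
`IwasawaDual.isTorsion_and_lambdaInvariant_eq_add_of_comparison` and `FineSelmerDualData.module_finite` finish.  No named fact is used.
[cite: DokchitserDokchitserAnnals2010, Lemma 4.14] [cite: CoatesSujatha2005, §3] [cite: GreenbergLNM1716, §1 p. 60, §4 p. 107]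
[cite: Washington1997, §13.2] -/
theorem lambdaShapiroFineAtTwo_holds : LambdaShapiroFineAtTwo := by
  intro W _ K _ _ hK _hH A _ C hA κ γ hκ hγ κK γK hκK hγK Y_W Y_A Dfi hfW htW hfA htA
  haveI := hfW
  haveI := hfA
  have h2 : Module.finrank ℚ K = 2 := hK.1
  have hL : ∀ w : NumberField.InfinitePlace K, w.IsComplex := fun w ↦ hK.2.isComplex w
  -- §1: `δ = √d_K ∈ K`, `θ ∈ ℚ̄`
  set d : ℚ := (NumberField.discr K : ℚ) with hd_def
  obtain ⟨δ, hδ, hδ2⟩ := exists_sq_eq_discr K h2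
  have hd0 : d ≠ 0 := sq_ne_zero_of_not_mem_range hδ hδ2
  set θ : AlgebraicClosure ℚ := rootInClosure K δ with hθ_def
  have hθ : θ ^ 2 = algebraMap ℚ (AlgebraicClosure ℚ) d := rootInClosure_sq K hδ2
  have hgalθ : ∀ σ : absoluteGaloisGroup ℚ, σ ∈ galRange (K := ℚ) K ↔ σ • θ = θ :=
    fun σ ↦ mem_galRange_iff_smul_eq h2 hδ hδ2 hθ σ
  haveI : (kerStab κ θ).Normal := normal_kerStab κ hθ
  have hgal : galImage ℚ K κK.kerSubgroup = kerStab κ θ := galImage_kerSubgroup_eq_kerStab hκ hκK hgalθ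
  -- `c ∈ ker κ` with `c θ = -θ`
  obtain ⟨c₀, hc₀⟩ := exists_smul_eq_neg h2 hδ hδ2 hθ
  have hsurj := ZpExtension.surjective_comp_absGaloisRestrict_of_forall_sq_ne_two κ K hκ (by rw [h2]; decide)
    (sq_ne_two_of_isImaginaryQuadratic hK)
  obtain ⟨σ₁, hσ₁⟩ := hsurj (κ c₀)
  set c : absoluteGaloisGroup ℚ := c₀ * (absGaloisRestrict ℚ K σ₁)⁻¹ with hc_def
  have hcκ : c ∈ κ.kerSubgroup := by
    rw [ZpExtension.mem_kerSubgroup, hc_def, map_mul, map_inv]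
    change κ c₀ * (κ (absGaloisRestrict ℚ K σ₁))⁻¹ = 1
    have h1 : κ (absGaloisRestrict ℚ K σ₁) = κ c₀ := hσ₁
    rw [h1, mul_inv_cancel]
  have hcθ : c • θ = -θ := by
    have hfix : (absGaloisRestrict ℚ K σ₁) • θ = θ := (hgalθ _).1 (by rw [← resGal_eq_absGaloisRestrict]; exact ⟨σ₁, rfl⟩)
    have hfix' : (absGaloisRestrict ℚ K σ₁)⁻¹ • θ = θ := by
      nth_rw 1 [← hfix]; rw [inv_smul_smul]
    rw [hc_def, mul_smul, hfix', hc₀]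
  -- the two sides of the model: `r₁ : H¹(kerStab) → H¹(galImage)`, `r₂` back, mutually inverse
  set N := galImage ℚ K κK.kerSubgroup with hN_def
  let r₁ : W.subgroupH1 2 (kerStab κ θ) →+ W.subgroupH1 2 N := W.resOfLe 2 hgal.le
  let r₂ : W.subgroupH1 2 N →+ W.subgroupH1 2 (kerStab κ θ) := W.resOfLe 2 hgal.ge
  have hr₂₁ : ∀ y, r₂ (r₁ y) = y := fun y ↦ by
    change ((W.resOfLe 2 hgal.ge).comp (W.resOfLe 2 hgal.le)) y = y
    rw [W.resOfLe_comp_holds 2]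
    exact congrArg (fun φ ↦ φ y) (resOfLe_refl_holds (M := W.geomPrimaryTorsion 2) (kerStab κ θ))
  have hr₁₂ : ∀ z, r₁ (r₂ z) = z := fun z ↦ by
    change ((W.resOfLe 2 hgal.le).comp (W.resOfLe 2 hgal.ge)) z = z
    rw [W.resOfLe_comp_holds 2]
    exact congrArg (fun φ ↦ φ z) (resOfLe_refl_holds (M := W.geomPrimaryTorsion 2) N)
  -- the genuine model `Θ : H¹(ker κ_K, E_K[2^∞]) ≃ H¹(galImage(ker κ_K), E[2^∞])`
  let Θ := subgroupModelIso ℚ K κK.kerSubgroup W 2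
  -- prime-wise local triviality transported from `kerStab` to `galImage`
  have hLT : ∀ y : W.subgroupH1 2 (kerStab κ θ),
      (∀ (𝔓 : Ideal (absIntegers (𝓞 ℚ) ℚ)), 𝔓.IsMaximal →
        W.resOfLe 2 (inf_le_left : kerStab κ θ ⊓ 𝔓.decompositionSubgroup (absoluteGaloisGroup ℚ) ≤ kerStab κ θ) y = 0) →
      ∀ (𝔓 : Ideal (absIntegers (𝓞 ℚ) ℚ)), 𝔓.IsMaximal →
        W.resOfLe 2 (inf_le_left : N ⊓ 𝔓.decompositionSubgroup (absoluteGaloisGroup ℚ) ≤ N) (r₁ y) = 0 :=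
    fun y hy 𝔓 h𝔓 ↦ forall_prime_resOfLe N hgal.le y hy 𝔓
  have hLT' : ∀ z : W.subgroupH1 2 N,
      (∀ (𝔓 : Ideal (absIntegers (𝓞 ℚ) ℚ)), 𝔓.IsMaximal →
        W.resOfLe 2 (inf_le_left : N ⊓ 𝔓.decompositionSubgroup (absoluteGaloisGroup ℚ) ≤ N) z = 0) →
      ∀ (𝔓 : Ideal (absIntegers (𝓞 ℚ) ℚ)), 𝔓.IsMaximal →
        W.resOfLe 2 (inf_le_left : kerStab κ θ ⊓ 𝔓.decompositionSubgroup (absoluteGaloisGroup ℚ) ≤ kerStab κ θ) (r₂ z) = 0 :=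
    fun z hz 𝔓 h𝔓 ↦ forall_prime_resOfLe (kerStab κ θ) hgal.ge z hz 𝔓
  -- the genuine fine Selmer group of `E_K` over `K_∞` (as Greenberg's strict Selmer group of the fine data, `rfl`)
  let SK : AddSubgroup ((W.baseChange K).subgroupH1 2 κK.kerSubgroup) :=
    GreenbergSelmer.strictSelmerInfty κK (↥((W.baseChange K).geomPrimaryTorsion 2))
      (GreenbergSelmer.fineData (↥((W.baseChange K).geomPrimaryTorsion 2)) 2)
  have hSK : SK = (W.baseChange K).fineSelmerInfty κK := rfl
  have hmemSK : ∀ y : W.subgroupH1 2 (kerStab κ θ),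
      (∀ (𝔓 : Ideal (absIntegers (𝓞 ℚ) ℚ)), 𝔓.IsMaximal →
        W.resOfLe 2 (inf_le_left : kerStab κ θ ⊓ 𝔓.decompositionSubgroup (absoluteGaloisGroup ℚ) ≤ kerStab κ θ) y = 0) →
      Θ.symm (r₁ y) ∈ SK := fun y hy ↦ by
    rw [hSK]
    refine mem_fineSelmerInfty_of_forall_prime_subgroupModelIso W κK hL _ fun 𝔓 h𝔓 ↦ ?_
    change W.resOfLe 2 _ (Θ (Θ.symm (r₁ y))) = 0
    rw [AddEquiv.apply_symm_apply]
    exact hLT y hy 𝔓 h𝔓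
  -- the comparison maps
  let Φ : ↥(W.fineSelmerInfty κ) →+ ↥SK :=
    ((Θ.symm : W.subgroupH1 2 N →+ (W.baseChange K).subgroupH1 2 κK.kerSubgroup).comp
      (r₁.comp ((W.resOfLe 2 (kerStab_le κ θ)).comp (W.fineSelmerInfty κ).subtype))).codRestrict SK fun s ↦
        hmemSK _ fun 𝔓 _ ↦ forall_prime_resOfLe_of_mem_fineSelmerInfty κ W s.2 𝔓
  let Φ' : ↥(A.fineSelmerInfty κ) →+ ↥SK :=
    ((Θ.symm : W.subgroupH1 2 N →+ (W.baseChange K).subgroupH1 2 κK.kerSubgroup).comp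
      (r₁.comp (((twistResEquiv W A hd0 hA hθ κ : A.subgroupH1 2 (kerStab κ θ) →+ W.subgroupH1 2 (kerStab κ θ)).comp
        ((A.resOfLe 2 (kerStab_le κ θ)).comp (A.fineSelmerInfty κ).subtype))))).codRestrict SK fun s' ↦
        hmemSK _ fun 𝔓 _ ↦ forall_prime_twistResEquiv_resOfLe_of_mem_fineSelmerInfty κ W A hd0 hA hθ s'.2 𝔓
  have hΦ : ∀ s : ↥(W.fineSelmerInfty κ), ((Φ s : ↥SK) : (W.baseChange K).subgroupH1 2 κK.kerSubgroup) =
      Θ.symm (r₁ (W.resOfLe 2 (kerStab_le κ θ) s)) := fun _ ↦ rfl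
  have hΦ' : ∀ s' : ↥(A.fineSelmerInfty κ), ((Φ' s' : ↥SK) : (W.baseChange K).subgroupH1 2 κK.kerSubgroup) =
      Θ.symm (r₁ (twistResEquiv W A hd0 hA hθ κ (A.resOfLe 2 (kerStab_le κ θ) s'))) := fun _ ↦ rfl
  -- kernel killed by `4`
  have hker : ∀ (s : ↥(W.fineSelmerInfty κ)) (s' : ↥(A.fineSelmerInfty κ)), Φ s + Φ' s' = 0 →
      2 ^ 2 • s = 0 ∧ 2 ^ 2 • s' = 0 := by
    intro s s' h0
    have h1 : Θ.symm (r₁ (W.resOfLe 2 (kerStab_le κ θ) s + twistResEquiv W A hd0 hA hθ κ (A.resOfLe 2 (kerStab_le κ θ) s'))) = 0 := by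
      rw [map_add, map_add, ← hΦ, ← hΦ', ← AddSubgroup.coe_add, h0, ZeroMemClass.coe_zero]
    have h2' : W.resOfLe 2 (kerStab_le κ θ) s + twistResEquiv W A hd0 hA hθ κ (A.resOfLe 2 (kerStab_le κ θ) s') = 0 := by
      have h := congrArg r₂ ((AddEquiv.map_eq_zero_iff _).1 h1)
      rwa [hr₂₁, map_zero] at h
    obtain ⟨h4, h4'⟩ := four_nsmul_eq_zero_of_fineRes_add_twistFineRes_eq_zero κ W A hd0 hA hθ hcκ hcθ s.2 s'.2 h2'
    exact ⟨Subtype.ext (by simpa using h4), Subtype.ext (by simpa using h4')⟩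
  -- `4 · Sel₀(K_∞, E_K)` in the image
  have hcoker : ∀ t : ↥SK, ∃ (s : ↥(W.fineSelmerInfty κ)) (s' : ↥(A.fineSelmerInfty κ)), Φ s + Φ' s' = 2 ^ 2 • t := by
    intro t
    have ht : (t : (W.baseChange K).subgroupH1 2 κK.kerSubgroup) ∈ (W.baseChange K).fineSelmerInfty κK := by
      rw [← hSK]; exact t.2
    have hζ := hLT' (Θ t) (fun 𝔓 _ ↦ forall_prime_subgroupModelIso_of_mem_fineSelmerInfty W κK ht 𝔓)
    obtain ⟨η, hη, η', hη', h⟩ := exists_fineRes_add_twistFineRes_eq_four_nsmul κ W A hd0 hA hθ hcκ hcθ (r₂ (Θ t)) hζ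
    refine ⟨⟨η, hη⟩, ⟨η', hη'⟩, Subtype.ext ?_⟩
    rw [AddSubgroup.coe_add, hΦ, hΦ', ← map_add, ← map_add, AddSubmonoidClass.coe_nsmul]
    change Θ.symm (r₁ (W.resOfLe 2 (kerStab_le κ θ) η + twistResEquiv W A hd0 hA hθ κ (A.resOfLe 2 (kerStab_le κ θ) η'))) = _
    rw [h, show (4 : ℕ) = 2 ^ 2 by norm_num, map_nsmul, map_nsmul, hr₁₂, AddEquiv.symm_apply_apply]
  -- `p`-primary groups
  have hS₁ : ∀ s : ↥(W.fineSelmerInfty κ), ∃ k : ℕ, 2 ^ k • s = 0 := fun s ↦ by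
    obtain ⟨k, hk⟩ := W.exists_pow_smul_subgroupH1_ker_eq_zero κ (s : W.subgroupH1 2 κ.kerSubgroup)
    exact ⟨k, Subtype.ext (by rw [AddSubmonoidClass.coe_nsmul, hk, ZeroMemClass.coe_zero])⟩
  have hS₁' : ∀ s : ↥(A.fineSelmerInfty κ), ∃ k : ℕ, 2 ^ k • s = 0 := fun s ↦ by
    obtain ⟨k, hk⟩ := A.exists_pow_smul_subgroupH1_ker_eq_zero κ (s : A.subgroupH1 2 κ.kerSubgroup)
    exact ⟨k, Subtype.ext (by rw [AddSubmonoidClass.coe_nsmul, hk, ZeroMemClass.coe_zero])⟩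
  -- `X₀(E/K_∞)` is finitely generated (Coates–Sujatha §3 / Greenberg p. 60, tree `FineSelmerDualData.module_finite`)
  let DfiY : (W.baseChange K).FineSelmerDualData κK γK :=
    { X := Dfi.X, toDual := Dfi.toDual, bijective := Dfi.bijective, toDual_T_smul := Dfi.toDual_T_smul,
      toDual_C_smul := Dfi.toDual_C_smul }
  haveI hfin : Module.Finite (IwasawaAlgebra 2) Dfi.X := FineSelmerDualData.module_finite (W := W.baseChange K) κK hγK DfiY
  -- the comparison theorem for Pontryagin duals
  obtain ⟨htors, hlam⟩ := isTorsion_and_lambdaInvariant_eq_add_of_comparison (p := 2)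
    Y_W.toDual Y_W.bijective Y_A.toDual Y_A.bijective Dfi.toDual Dfi.bijective Φ Φ' hS₁ hS₁'
    Y_W.toDual_C_smul Y_A.toDual_C_smul Dfi.toDual_C_smul (j := 2) hker hcoker htW htA
  exact ⟨⟨hfin, htors⟩, hlam⟩

end Main

/-! ## §4 Stub 4‴ from PRINT alone -/

/-- **Stub 4‴ `ThetaShapiroKatoGreenbergSupplyAtTwo` from the SIX printed named facts {PUB, F3-K, (12.2.3), X₀-torsion, Kato 12.4, PT-K}**
— GEN 31's `thetaShapiroKatoGreenbergSupplyAtTwo_of_print` with ORD fed by the tree theorem `Kato2004.tateModuleFilAt_inertia_ordinary_holds`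
(audit-2 p701851) and the memo binder (S) fed by `lambdaShapiroFineAtTwo_holds` (§3).  HONEST FRAMING: the crux `OrdLambdaHalfAtTwo` is NOT
proved (stub 6‴ open); BSD is not proved by any of this. [cite: Kato2004Asterisque, Thm. 12.4, Thm. 12.5, Thm. 16.6, Thm. 17.4, §17.13]
[cite: GreenbergLNM1716, Thm. 1.14 (p. 68)] -/
theorem thetaShapiroKatoGreenbergSupplyAtTwo_of_print'
    (hPub : Literature.Uncategorized.OrdConversePublishedInputsAtTwo)
    (hF3K : Kato2004.exists_zetaClass_colemanMinus_recLaw_index_two)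
    (hHl : Kato2004.localIwasawaH1_tateRep_moduleFinite)
    (hX₀ : Kato2004_fineSelmerDual_isTorsion)
    (h124 : Kato2004.thm12_4)
    (hPTK : Kato2004.poitouTate_shapiroLattice_bdp_two) :
    TwoAdicKatoDeterminant.ThetaShapiroKatoGreenbergSupplyAtTwo :=
  TwoAdicThetaSupply.thetaShapiroKatoGreenbergSupplyAtTwo_of_print hPub hF3K Kato2004.tateModuleFilAt_inertia_ordinary_holds hHl hX₀
    h124 hPTK lambdaShapiroFineAtTwo_holds

end Summit.BirchSwinnertonDyer.BirchSwinnertonDyer.Theorems.TwoAdicShapiroPT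

end
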